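import Mathlib
import Literature.NumberTheory.Sieve.MoebiusCoprimeProgressions
import Literature.NumberTheory.LFunctions.SiegelWalfiszMoebiusProofs
import Literature.NumberTheory.Sieve.MoebiusExpSum
import HarnessLib

/-!
# Tail sums `Σ_{A < n ≤ W, (n,q)=1} μ(n)/n` and `Σ μ(n) log n / n`, uniformly in `q`

Topic `Literature/NumberTheory/Sieve`.  PROVED consequences of the Siegel–Walfisz theorem for `μ`
(`Literature.NumberTheory.LFunctions.SiegelWalfiszMoebius_holds`) through the tree's coprime form
`SiegelWalfiszMoebius.sum_coprime_progression_le` (`MoebiusCoprimeProgressions.lean`): for every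
`B ≥ 0` there is `C` such that for all `q ≥ 1` and `2 ≤ A ≤ W`,

* `abs_sum_coprime_moebius_le_logPow` — `|Σ_{n ≤ y, (n,q)=1} μ(n)| ≤ C 4^{ω(q)} y (log y)^{−B}`
  (`y ≥ 2`; the case `k = 1` of the progression form);
* `abs_sum_Ioc_coprime_moebius_div_le` — `|Σ_{A < n ≤ W, (n,q)=1} μ(n)/n| ≤ C 4^{ω(q)} (log A)^{−B}`;
* `abs_sum_Ioc_coprime_moebius_mul_log_div_le` —
  `|Σ_{A < n ≤ W, (n,q)=1} μ(n) log n / n| ≤ C 4^{ω(q)} (log A)^{−B}`;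
* `sum_four_pow_card_primeFactors_div_le` — `Σ_{d ≤ Q} 4^{ω(d)}/d ≤ (1 + log Q)⁴`, the companion
  bound that sums the factor `4^{ω(q)}` over the modulus.

Method: Abel summation (Mathlib's `sum_mul_eq_sub_sub_integral_mul`) with `f(t) = 1/t`,
resp. `f(t) = log t / t`, against `M_q(t) = Σ_{n ≤ t, (n,q)=1} μ(n) ≪ 4^{ω(q)} t (log t)^{−B−3}`;
the boundary terms are `≪ (log A)^{−B}` and the integral is dominated by
`4^{ω(q)} (log A)^{−B} ∫_A^W dt/(t log² t) = 4^{ω(q)} (log A)^{−B} (1/log A − 1/log W)`.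
These are the standard inputs for the convergence, with a rate, of singular-series-type sums
`Σ_d μ(d) c(d) log d / d` with coefficients depending on `gcd(d, k)`.

## References

* H. L. Montgomery, R. C. Vaughan, *Multiplicative Number Theory I*, CUP 2007, §11.3 (Siegel–Walfisz
  for `μ`), §6.2 (partial summation of `μ(n)/n`). [folklore]
-/

noncomputable section

open Finset Real MeasureTheory
open scoped ArithmeticFunction.Moebius ArithmeticFunction.omega

namespace Literature.NumberTheory.Sieve.MoebiusCoprimeTail

/-! ### `Σ 4^{ω(d)}/d` -/

/-- `Σ_{d ≤ Q} 4^{ω(d)}/d ≤ (1 + log Q)⁴` (from `4^{ω(d)} ≤ τ(d)²` and `Σ τ(d)²/d ≤ (1 + log Q)⁴`).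
[folklore] -/
theorem sum_four_pow_card_primeFactors_div_le (Q : ℕ) :
    ∑ d ∈ Icc 1 Q, (4 : ℝ) ^ d.primeFactors.card / d ≤ (1 + Real.log Q) ^ 4 := by
  have hτ := MoebiusExpSum.sum_sq_card_divisors_div_le Q
  have e : Icc 1 Q = Ioc 0 Q := rfl
  rw [e]
  refine le_trans (Finset.sum_le_sum fun d hd => ?_) (by exact_mod_cast hτ)
  have hd0 : d ≠ 0 := by have := (mem_Ioc.1 hd).1; omega
  have h4 := four_pow_card_primeFactors_le_sigma_zero_sq hd0
  rw [ArithmeticFunction.sigma_zero_apply] at h4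
  push_cast
  exact div_le_div_of_nonneg_right h4 (Nat.cast_nonneg _)

/-! ### `M_q(y) = Σ_{n ≤ y, (n,q)=1} μ(n)` -/

/-- **Möbius sums with a coprimality condition** (Siegel–Walfisz strength, unconditional): for
`B ≥ 0` there is `C ≥ 0` with `|Σ_{n ≤ y, (n,q)=1} μ(n)| ≤ C 4^{ω(q)} y (log y)^{−B}` for all `y ≥ 2`
and `q ≥ 1`. [folklore] -/
theorem abs_sum_coprime_moebius_le_logPow {B : ℝ} (hB : 0 ≤ B) :
    ∃ C : ℝ, 0 ≤ C ∧ ∀ q : ℕ, q ≠ 0 → ∀ y : ℝ, 2 ≤ y →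
      |∑ n ∈ (Icc 1 ⌊y⌋₊).filter (fun n : ℕ => n.Coprime q), (μ n : ℝ)| ≤
        C * (4 : ℝ) ^ q.primeFactors.card * y / Real.log y ^ B := by
  obtain ⟨C, hC0, hC⟩ := LFunctions.SiegelWalfiszMoebius.sum_coprime_progression_le
    LFunctions.SiegelWalfiszMoebius_holds (A := 1) one_pos hB
  refine ⟨max C 1, le_max_of_le_right zero_le_one, fun q hq y hy => ?_⟩
  have hy0 : 0 < y := by linarith
  have hlogy : 0 < Real.log y := Real.log_pos (by linarith)
  have h4 : (1 : ℝ) ≤ (4 : ℝ) ^ q.primeFactors.card := one_le_pow₀ (by norm_num)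
  rcases le_or_gt 1 (Real.log y) with hly | hly
  · -- `log y ≥ 1`: the Siegel–Walfisz input with modulus `k = 1`
    have hlog : ((1 : ℕ) : ℝ) ≤ Real.log y ^ (1 : ℝ) := by
      rw [Real.rpow_one]; exact_mod_cast hly
    have h := hC y hy 1 le_rfl hlog (0 : ZMod 1) (isUnit_of_subsingleton _) q hq
    have hfilter : (Icc 1 ⌊y⌋₊).filter (fun n : ℕ => ((n : ZMod 1) = 0 ∧ n.Coprime q)) =
        (Icc 1 ⌊y⌋₊).filter (fun n : ℕ => n.Coprime q) := by
      refine Finset.filter_congr fun n _ => ?_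
      simp only [Subsingleton.elim (n : ZMod 1) 0, true_and]
    rw [hfilter] at h
    refine h.trans ?_
    have : 0 ≤ (4 : ℝ) ^ q.primeFactors.card * y / Real.log y ^ B := by positivity
    calc C * (4 : ℝ) ^ q.primeFactors.card * y / Real.log y ^ B
        = C * ((4 : ℝ) ^ q.primeFactors.card * y / Real.log y ^ B) := by ring
      _ ≤ max C 1 * ((4 : ℝ) ^ q.primeFactors.card * y / Real.log y ^ B) :=
          mul_le_mul_of_nonneg_right (le_max_left _ _) this
      _ = max C 1 * (4 : ℝ) ^ q.primeFactors.card * y / Real.log y ^ B := by ring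
  · -- `log y < 1`: the trivial bound `|M_q(y)| ≤ y ≤ 4^ω y (log y)^{-B}`
    have htriv : |∑ n ∈ (Icc 1 ⌊y⌋₊).filter (fun n : ℕ => n.Coprime q), (μ n : ℝ)| ≤ y := by
      calc |∑ n ∈ (Icc 1 ⌊y⌋₊).filter (fun n : ℕ => n.Coprime q), (μ n : ℝ)|
          ≤ ∑ n ∈ (Icc 1 ⌊y⌋₊).filter (fun n : ℕ => n.Coprime q), |(μ n : ℝ)| :=
            Finset.abs_sum_le_sum_abs _ _
        _ ≤ ∑ n ∈ (Icc 1 ⌊y⌋₊).filter (fun n : ℕ => n.Coprime q), (1 : ℝ) :=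
            Finset.sum_le_sum fun n _ => by exact_mod_cast ArithmeticFunction.abs_moebius_le_one
        _ ≤ ∑ n ∈ Icc 1 ⌊y⌋₊, (1 : ℝ) :=
            Finset.sum_le_sum_of_subset_of_nonneg (Finset.filter_subset _ _)
              (fun _ _ _ => zero_le_one)
        _ = ⌊y⌋₊ := by simp
        _ ≤ y := Nat.floor_le hy0.le
    have hpow : Real.log y ^ B ≤ 1 := Real.rpow_le_one hlogy.le hly.le hB
    have hpow0 : 0 < Real.log y ^ B := Real.rpow_pos_of_pos hlogy B
    refine htriv.trans ?_
    rw [le_div_iff₀ hpow0]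
    have h1 : y * Real.log y ^ B ≤ y * 1 := mul_le_mul_of_nonneg_left hpow hy0.le
    have h2 : y ≤ max C 1 * (4 : ℝ) ^ q.primeFactors.card * y := by
      have : (1 : ℝ) ≤ max C 1 * (4 : ℝ) ^ q.primeFactors.card :=
        one_le_mul_of_one_le_of_one_le (le_max_right _ _) h4
      nlinarith
    linarith

/-! ### Abel summation against `M_q` -/

section Abel

variable {q : ℕ} {C₄ B : ℝ}

/-- The coefficient sequence `c(n) = [ (n,q)=1 ] μ(n)` (real). [folklore] -/
theorem sum_Icc_zero_ite_coprime_moebius_eq (q : ℕ) (t : ℝ) :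
    ∑ k ∈ Icc 0 ⌊t⌋₊, (if k.Coprime q then (μ k : ℝ) else 0) =
      ∑ n ∈ (Icc 1 ⌊t⌋₊).filter (fun n : ℕ => n.Coprime q), (μ n : ℝ) := by
  rw [Finset.sum_filter, Finset.Icc_eq_cons_Ioc (Nat.zero_le _), Finset.sum_cons]
  simp only [ArithmeticFunction.map_zero, Int.cast_zero, ite_self, zero_add]
  rfl

/-- `∫_A^W dt/(t log² t) = 1/log A − 1/log W` for `1 < A ≤ W`. [folklore] -/
theorem integral_inv_mul_log_sq {A W : ℝ} (hA : 1 < A) (hAW : A ≤ W) :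
    ∫ t in A..W, 1 / (t * Real.log t ^ 2) = 1 / Real.log A - 1 / Real.log W := by
  have hderiv : ∀ t ∈ Set.uIcc A W, HasDerivAt (fun t : ℝ => -(Real.log t)⁻¹)
      (1 / (t * Real.log t ^ 2)) t := by
    intro t ht
    rw [Set.uIcc_of_le hAW] at ht
    have ht0 : 0 < t := by linarith [ht.1]
    have hlt : Real.log t ≠ 0 := (Real.log_pos (by linarith [ht.1])).ne'
    have h1 : HasDerivAt (fun t : ℝ => Real.log t) t⁻¹ t := Real.hasDerivAt_log ht0.ne'
    have h2 := (h1.inv hlt).neg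
    have h3 : -(-t⁻¹ / Real.log t ^ 2) = 1 / (t * Real.log t ^ 2) := by
      rw [neg_div, neg_neg, inv_eq_one_div, div_div]
    rw [h3] at h2
    exact h2
  have hcont : ContinuousOn (fun t : ℝ => 1 / (t * Real.log t ^ 2)) (Set.uIcc A W) := by
    rw [Set.uIcc_of_le hAW]
    refine ContinuousOn.div continuousOn_const ?_ ?_
    · exact ContinuousOn.mul continuousOn_id
        ((Real.continuousOn_log.mono (fun t ht =>
          Set.mem_compl_singleton_iff.2 (ne_of_gt (show (0 : ℝ) < t by linarith [ht.1])))).pow 2)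
    · intro t ht
      have hlt : Real.log t ≠ 0 := (Real.log_pos (by linarith [ht.1])).ne'
      have ht0 : t ≠ 0 := by linarith [ht.1]
      positivity
  rw [intervalIntegral.integral_eq_sub_of_hasDerivAt hderiv (hcont.intervalIntegrable)]
  simp only [one_div]
  ring

/-- **Abel summation bound, weight `g`.**  Let `|Σ_{n ≤ t, (n,q)=1} μ(n)| ≤ C₄ t (log t)^{−(B+3)}`
for `t ≥ 2`, and let `g` be differentiable on `[A, W]` (`2 ≤ A ≤ W`) with continuous derivative,
`|g(t)| ≤ K log t / t` and `|g'(t)| ≤ K log t / t²` there.  Then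
`|Σ_{A < n ≤ W, (n,q)=1} μ(n) g(n)| ≤ 10 K C₄ (log A)^{−B}`
(Abel summation: two boundary terms `≤ 4KC₄(log A)^{−B}` each, using `(log 2)^{−2} ≤ 4`, and
`|∫_A^W g' M_q| ≤ K C₄ (log A)^{−B} ∫_A^W dt/(t log²t) ≤ 2 K C₄ (log A)^{−B}`). [folklore] -/
theorem abs_sum_Ioc_mul_le_of_abel (hC₄ : 0 ≤ C₄) (hB : 0 ≤ B)
    (hM : ∀ t : ℝ, 2 ≤ t →
      |∑ n ∈ (Icc 1 ⌊t⌋₊).filter (fun n : ℕ => n.Coprime q), (μ n : ℝ)| ≤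
        C₄ * t / Real.log t ^ (B + 3))
    {g : ℝ → ℝ} {K : ℝ} (hK : 0 ≤ K) {A W : ℝ} (hA : 2 ≤ A) (hAW : A ≤ W)
    (hg_diff : ∀ t ∈ Set.Icc A W, DifferentiableAt ℝ g t)
    (hg_cont : ContinuousOn (deriv g) (Set.Icc A W))
    (hg : ∀ t ∈ Set.Icc A W, |g t| ≤ K * Real.log t / t)
    (hg' : ∀ t ∈ Set.Icc A W, |deriv g t| ≤ K * Real.log t / t ^ 2) :
    |∑ n ∈ (Ioc ⌊A⌋₊ ⌊W⌋₊).filter (fun n : ℕ => n.Coprime q), (μ n : ℝ) * g n| ≤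
      10 * K * C₄ / Real.log A ^ B := by
  set c : ℕ → ℝ := fun k => if k.Coprime q then (μ k : ℝ) else 0 with hc
  have hA0 : 0 ≤ A := by linarith
  have hA1 : 1 < A := by linarith
  have hlogA : 0 < Real.log A := Real.log_pos hA1
  have hl2 : (1 : ℝ) / 2 < Real.log 2 := by have := Real.log_two_gt_d9; linarith
  have hBpos : 0 < Real.log A ^ B := Real.rpow_pos_of_pos hlogA B
  -- Abel summation
  have hg_int : IntegrableOn (deriv g) (Set.Icc A W) := hg_cont.integrableOn_Icc
  have habel := sum_mul_eq_sub_sub_integral_mul c hA0 hAW hg_diff hg_int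
  have hsum : ∑ n ∈ (Ioc ⌊A⌋₊ ⌊W⌋₊).filter (fun n : ℕ => n.Coprime q), (μ n : ℝ) * g n =
      ∑ k ∈ Ioc ⌊A⌋₊ ⌊W⌋₊, g k * c k := by
    rw [Finset.sum_filter]
    refine Finset.sum_congr rfl fun k _ => ?_
    simp only [hc]
    split_ifs <;> ring
  rw [hsum, habel]
  simp only [hc, sum_Icc_zero_ite_coprime_moebius_eq]
  set M : ℝ → ℝ := fun t => ∑ n ∈ (Icc 1 ⌊t⌋₊).filter (fun n : ℕ => n.Coprime q), (μ n : ℝ)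
    with hMdef
  -- `log t/(log t)^{B+3} ≤ (log A)^{-B} (log t)^{-2}` for `t ≥ A`
  have hpow_split : ∀ t : ℝ, A ≤ t →
      Real.log t / Real.log t ^ (B + 3) ≤ (Real.log A ^ B)⁻¹ * (Real.log t ^ 2)⁻¹ := by
    intro t ht
    have hlt : 0 < Real.log t := Real.log_pos (by linarith)
    have hlAt : Real.log A ≤ Real.log t := Real.log_le_log (by linarith) ht
    have e1 : Real.log t ^ (B + 3) = Real.log t ^ B * Real.log t ^ (3 : ℝ) := by
      rw [Real.rpow_add hlt]
    have e3 : Real.log t ^ (3 : ℝ) = Real.log t ^ 2 * Real.log t := by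
      rw [show (3 : ℝ) = ((3 : ℕ) : ℝ) by norm_num, Real.rpow_natCast]; ring
    rw [e1, e3]
    have hB' : Real.log A ^ B ≤ Real.log t ^ B := Real.rpow_le_rpow hlogA.le hlAt hB
    calc Real.log t / (Real.log t ^ B * (Real.log t ^ 2 * Real.log t))
        = (Real.log t ^ B)⁻¹ * (Real.log t ^ 2)⁻¹ := by
          field_simp
      _ ≤ (Real.log A ^ B)⁻¹ * (Real.log t ^ 2)⁻¹ := by
          gcongr
  -- `(log t)^{-2} ≤ 4` for `t ≥ A ≥ 2`
  have hlog_sq : ∀ t : ℝ, A ≤ t → (Real.log t ^ 2)⁻¹ ≤ 4 := by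
    intro t ht
    have hl2t : Real.log 2 ≤ Real.log t := Real.log_le_log two_pos (hA.trans ht)
    have h14 : (1 : ℝ) / 4 ≤ Real.log t ^ 2 := by nlinarith
    rw [inv_le_comm₀ (by nlinarith) (by norm_num)]
    linarith
  -- boundary terms
  have hbdry : ∀ t : ℝ, t ∈ Set.Icc A W → |g t * M t| ≤ 4 * K * C₄ / Real.log A ^ B := by
    intro t htI
    have ht : A ≤ t := htI.1
    have ht0 : 0 < t := by linarith
    have hlt : 0 < Real.log t := Real.log_pos (by linarith)
    rw [abs_mul]
    calc |g t| * |M t| ≤ (K * Real.log t / t) * (C₄ * t / Real.log t ^ (B + 3)) :=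
          mul_le_mul (hg t htI) (hM t (hA.trans ht)) (abs_nonneg _) (by positivity)
      _ = K * C₄ * (Real.log t / Real.log t ^ (B + 3)) := by
          field_simp
      _ ≤ K * C₄ * ((Real.log A ^ B)⁻¹ * (Real.log t ^ 2)⁻¹) :=
          mul_le_mul_of_nonneg_left (hpow_split t ht) (by positivity)
      _ ≤ K * C₄ * ((Real.log A ^ B)⁻¹ * 4) := by
          gcongr
          exact hlog_sq t ht
      _ = 4 * K * C₄ / Real.log A ^ B := by
          field_simp
  -- the integral
  have hAW' : Set.Ioc A W ⊆ Set.Icc A W := Set.Ioc_subset_Icc_self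
  set G : ℝ → ℝ := fun t => K * C₄ * (Real.log A ^ B)⁻¹ * (1 / (t * Real.log t ^ 2)) with hG
  have hGcont : ContinuousOn (fun t : ℝ => 1 / (t * Real.log t ^ 2)) (Set.Icc A W) := by
    refine ContinuousOn.div continuousOn_const ?_ ?_
    · exact ContinuousOn.mul continuousOn_id
        ((Real.continuousOn_log.mono (fun t ht =>
          Set.mem_compl_singleton_iff.2 (ne_of_gt (show (0 : ℝ) < t by linarith [ht.1])))).pow 2)
    · intro t ht
      have hlt : Real.log t ≠ 0 := (Real.log_pos (by linarith [ht.1])).ne'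
      have ht0 : t ≠ 0 := by linarith [ht.1]
      positivity
  have hGint : IntegrableOn G (Set.Ioc A W) := by
    have h1 : ContinuousOn G (Set.Icc A W) := continuousOn_const.mul hGcont
    exact (h1.integrableOn_Icc).mono_set hAW'
  have hint_bound : |∫ t in Set.Ioc A W, deriv g t * M t| ≤ ∫ t in Set.Ioc A W, G t := by
    rw [← Real.norm_eq_abs]
    refine norm_integral_le_of_norm_le hGint ?_
    refine ae_restrict_of_forall_mem measurableSet_Ioc fun t ht => ?_
    have htI : t ∈ Set.Icc A W := hAW' ht
    have hAt : A ≤ t := ht.1.le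
    have ht0 : 0 < t := by linarith [ht.1]
    have hlt : 0 < Real.log t := Real.log_pos (by linarith [ht.1])
    rw [Real.norm_eq_abs, abs_mul]
    calc |deriv g t| * |M t| ≤ (K * Real.log t / t ^ 2) * (C₄ * t / Real.log t ^ (B + 3)) :=
          mul_le_mul (hg' t htI) (hM t (hA.trans hAt)) (abs_nonneg _) (by positivity)
      _ = K * C₄ * (Real.log t / Real.log t ^ (B + 3)) * (1 / t) := by
          field_simp
      _ ≤ K * C₄ * ((Real.log A ^ B)⁻¹ * (Real.log t ^ 2)⁻¹) * (1 / t) := by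
          gcongr
          exact hpow_split t hAt
      _ = G t := by
          simp only [hG]
          field_simp
  have hint_val : ∫ t in Set.Ioc A W, G t =
      K * C₄ * (Real.log A ^ B)⁻¹ * (1 / Real.log A - 1 / Real.log W) := by
    simp only [hG]
    rw [integral_const_mul, ← intervalIntegral.integral_of_le hAW,
      integral_inv_mul_log_sq hA1 hAW]
  have hint_le : |∫ t in Set.Ioc A W, deriv g t * M t| ≤ 2 * K * C₄ / Real.log A ^ B := by
    refine hint_bound.trans ?_
    rw [hint_val]
    have hlW : 0 < Real.log W := Real.log_pos (by linarith)
    have h1 : 1 / Real.log A - 1 / Real.log W ≤ 2 := by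
      have : 1 / Real.log A ≤ 2 := by
        rw [div_le_iff₀ hlogA]
        have := Real.log_le_log two_pos hA
        linarith
      have : 0 ≤ 1 / Real.log W := by positivity
      linarith
    calc K * C₄ * (Real.log A ^ B)⁻¹ * (1 / Real.log A - 1 / Real.log W)
        ≤ K * C₄ * (Real.log A ^ B)⁻¹ * 2 :=
          mul_le_mul_of_nonneg_left h1 (by positivity)
      _ = 2 * K * C₄ / Real.log A ^ B := by
          field_simp
  -- assemble
  have hW : W ∈ Set.Icc A W := ⟨hAW, le_rfl⟩
  have hAm : A ∈ Set.Icc A W := ⟨le_rfl, hAW⟩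
  calc |g W * M W - g A * M A - ∫ t in Set.Ioc A W, deriv g t * M t|
      ≤ |g W * M W| + |g A * M A| + |∫ t in Set.Ioc A W, deriv g t * M t| := by
        have := abs_sub (g W * M W - g A * M A) (∫ t in Set.Ioc A W, deriv g t * M t)
        have := abs_sub (g W * M W) (g A * M A)
        linarith
    _ ≤ 4 * K * C₄ / Real.log A ^ B + 4 * K * C₄ / Real.log A ^ B + 2 * K * C₄ / Real.log A ^ B :=
        add_le_add (add_le_add (hbdry W hW) (hbdry A hAm)) hint_le
    _ = 10 * K * C₄ / Real.log A ^ B := by ring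

end Abel

/-! ### The two tail sums -/

/-- **Tail of `Σ μ(n)/n` over `(n, q) = 1`**: for `B ≥ 0` there is `C ≥ 0` with
`|Σ_{A < n ≤ W, (n,q)=1} μ(n)/n| ≤ C 4^{ω(q)} (log A)^{−B}` for all `q ≥ 1`, `2 ≤ A ≤ W`. [folklore] -/
theorem abs_sum_Ioc_coprime_moebius_div_le {B : ℝ} (hB : 0 ≤ B) :
    ∃ C : ℝ, 0 ≤ C ∧ ∀ q : ℕ, q ≠ 0 → ∀ A W : ℝ, 2 ≤ A → A ≤ W →
      |∑ n ∈ (Ioc ⌊A⌋₊ ⌊W⌋₊).filter (fun n : ℕ => n.Coprime q), (μ n : ℝ) / n| ≤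
        C * (4 : ℝ) ^ q.primeFactors.card / Real.log A ^ B := by
  obtain ⟨C₀, hC₀, hM⟩ := abs_sum_coprime_moebius_le_logPow (B := B + 3) (by linarith)
  refine ⟨20 * C₀, by positivity, fun q hq A W hA hAW => ?_⟩
  set C₄ : ℝ := C₀ * (4 : ℝ) ^ q.primeFactors.card with hC₄
  have hC₄0 : 0 ≤ C₄ := by positivity
  have hM' : ∀ t : ℝ, 2 ≤ t →
      |∑ n ∈ (Icc 1 ⌊t⌋₊).filter (fun n : ℕ => n.Coprime q), (μ n : ℝ)| ≤
        C₄ * t / Real.log t ^ (B + 3) := fun t ht => hM q hq t ht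
  have hl2 : (1 : ℝ) / 2 < Real.log 2 := by have := Real.log_two_gt_d9; linarith
  -- `g(t) = 1/t`, `K = 2`
  have hg_diff : ∀ t ∈ Set.Icc A W, DifferentiableAt ℝ (fun t : ℝ => t⁻¹) t := fun t ht =>
    differentiableAt_inv_iff.mpr (by linarith [ht.1] : t ≠ 0)
  have hderiv : deriv (fun t : ℝ => t⁻¹) = fun t => -(t ^ 2)⁻¹ := by
    funext t; exact deriv_inv
  have hg_cont : ContinuousOn (deriv fun t : ℝ => t⁻¹) (Set.Icc A W) := by
    rw [hderiv]
    refine ContinuousOn.neg (ContinuousOn.inv₀ (continuousOn_pow 2) ?_)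
    intro t ht; exact pow_ne_zero 2 (by linarith [ht.1] : t ≠ 0)
  have hg : ∀ t ∈ Set.Icc A W, |(fun t : ℝ => t⁻¹) t| ≤ 2 * Real.log t / t := by
    intro t ht
    have ht0 : 0 < t := by linarith [ht.1]
    have hlt : Real.log 2 ≤ Real.log t := Real.log_le_log two_pos (hA.trans ht.1)
    simp only
    rw [abs_of_pos (inv_pos.2 ht0), inv_eq_one_div]
    exact div_le_div_of_nonneg_right (by linarith) ht0.le
  have hg' : ∀ t ∈ Set.Icc A W, |deriv (fun t : ℝ => t⁻¹) t| ≤ 2 * Real.log t / t ^ 2 := by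
    intro t ht
    have ht0 : 0 < t := by linarith [ht.1]
    have hlt : Real.log 2 ≤ Real.log t := Real.log_le_log two_pos (hA.trans ht.1)
    rw [hderiv]
    simp only
    rw [abs_neg, abs_of_pos (inv_pos.2 (pow_pos ht0 2)), inv_eq_one_div]
    exact div_le_div_of_nonneg_right (by linarith) (pow_pos ht0 2).le
  have h := abs_sum_Ioc_mul_le_of_abel hC₄0 hB hM' (by norm_num : (0 : ℝ) ≤ 2) hA hAW
    hg_diff hg_cont hg hg'
  have hsum : ∑ n ∈ (Ioc ⌊A⌋₊ ⌊W⌋₊).filter (fun n : ℕ => n.Coprime q), (μ n : ℝ) / n =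
      ∑ n ∈ (Ioc ⌊A⌋₊ ⌊W⌋₊).filter (fun n : ℕ => n.Coprime q), (μ n : ℝ) * (fun t : ℝ => t⁻¹) n :=
    Finset.sum_congr rfl fun n _ => by simp only [div_eq_mul_inv]
  rw [hsum]
  refine h.trans (le_of_eq ?_)
  rw [hC₄]; ring

/-- **Tail of `Σ μ(n) log n / n` over `(n, q) = 1`**: for `B ≥ 0` there is `C ≥ 0` with
`|Σ_{A < n ≤ W, (n,q)=1} μ(n) log n / n| ≤ C 4^{ω(q)} (log A)^{−B}` for all `q ≥ 1`, `2 ≤ A ≤ W`.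
[folklore] -/
theorem abs_sum_Ioc_coprime_moebius_mul_log_div_le {B : ℝ} (hB : 0 ≤ B) :
    ∃ C : ℝ, 0 ≤ C ∧ ∀ q : ℕ, q ≠ 0 → ∀ A W : ℝ, 2 ≤ A → A ≤ W →
      |∑ n ∈ (Ioc ⌊A⌋₊ ⌊W⌋₊).filter (fun n : ℕ => n.Coprime q), (μ n : ℝ) * Real.log n / n| ≤
        C * (4 : ℝ) ^ q.primeFactors.card / Real.log A ^ B := by
  obtain ⟨C₀, hC₀, hM⟩ := abs_sum_coprime_moebius_le_logPow (B := B + 3) (by linarith)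
  refine ⟨30 * C₀, by positivity, fun q hq A W hA hAW => ?_⟩
  set C₄ : ℝ := C₀ * (4 : ℝ) ^ q.primeFactors.card with hC₄
  have hC₄0 : 0 ≤ C₄ := by positivity
  have hM' : ∀ t : ℝ, 2 ≤ t →
      |∑ n ∈ (Icc 1 ⌊t⌋₊).filter (fun n : ℕ => n.Coprime q), (μ n : ℝ)| ≤
        C₄ * t / Real.log t ^ (B + 3) := fun t ht => hM q hq t ht
  have hl2 : (1 : ℝ) / 2 < Real.log 2 := by have := Real.log_two_gt_d9; linarith
  -- `g(t) = log t / t`, `K = 3`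
  set g : ℝ → ℝ := fun t => Real.log t / t with hgdef
  have hgd : ∀ t : ℝ, 0 < t → HasDerivAt g ((1 - Real.log t) / t ^ 2) t := by
    intro t ht
    have h1 := (Real.hasDerivAt_log ht.ne').div (hasDerivAt_id t) ht.ne'
    have e : (t⁻¹ * id t - Real.log t * 1) / id t ^ 2 = (1 - Real.log t) / t ^ 2 := by
      simp only [id]
      rw [inv_mul_cancel₀ ht.ne', mul_one]
    rw [e] at h1
    exact h1
  have hg_diff : ∀ t ∈ Set.Icc A W, DifferentiableAt ℝ g t := fun t ht =>
    (hgd t (by linarith [ht.1])).differentiableAt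
  have hderiv : ∀ t ∈ Set.Icc A W, deriv g t = (1 - Real.log t) / t ^ 2 := fun t ht =>
    (hgd t (by linarith [ht.1])).deriv
  have hg_cont : ContinuousOn (deriv g) (Set.Icc A W) := by
    have hc : ContinuousOn (fun t : ℝ => (1 - Real.log t) / t ^ 2) (Set.Icc A W) := by
      refine ContinuousOn.div (continuousOn_const.sub (Real.continuousOn_log.mono
        (fun t ht => Set.mem_compl_singleton_iff.2
          (ne_of_gt (show (0 : ℝ) < t by linarith [ht.1]))))) (continuousOn_pow 2) ?_
      intro t ht; exact pow_ne_zero 2 (by linarith [ht.1] : t ≠ 0)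
    exact hc.congr hderiv
  have hg : ∀ t ∈ Set.Icc A W, |g t| ≤ 3 * Real.log t / t := by
    intro t ht
    have ht0 : 0 < t := by linarith [ht.1]
    have hlt : Real.log 2 ≤ Real.log t := Real.log_le_log two_pos (hA.trans ht.1)
    have hlt0 : 0 ≤ Real.log t := by linarith
    simp only [hgdef]
    rw [abs_of_nonneg (div_nonneg hlt0 ht0.le)]
    exact div_le_div_of_nonneg_right (by linarith) ht0.le
  have hg' : ∀ t ∈ Set.Icc A W, |deriv g t| ≤ 3 * Real.log t / t ^ 2 := by
    intro t ht
    have ht0 : 0 < t := by linarith [ht.1]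
    have hlt : Real.log 2 ≤ Real.log t := Real.log_le_log two_pos (hA.trans ht.1)
    rw [hderiv t ht, abs_div, abs_of_pos (pow_pos ht0 2)]
    refine div_le_div_of_nonneg_right ?_ (pow_pos ht0 2).le
    have : |1 - Real.log t| ≤ 1 + Real.log t := by
      rw [abs_le]; constructor <;> linarith
    linarith
  have h := abs_sum_Ioc_mul_le_of_abel hC₄0 hB hM' (by norm_num : (0 : ℝ) ≤ 3) hA hAW
    hg_diff hg_cont hg hg'
  have hsum : ∑ n ∈ (Ioc ⌊A⌋₊ ⌊W⌋₊).filter (fun n : ℕ => n.Coprime q),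
      (μ n : ℝ) * Real.log n / n =
      ∑ n ∈ (Ioc ⌊A⌋₊ ⌊W⌋₊).filter (fun n : ℕ => n.Coprime q), (μ n : ℝ) * g n :=
    Finset.sum_congr rfl fun n _ => by simp only [hgdef]; ring
  rw [hsum]
  refine h.trans (le_of_eq ?_)
  rw [hC₄]; ring

end Literature.NumberTheory.Sieve.MoebiusCoprimeTail

end
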